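import Summits.PneNP.PneNP.Theses.RamseyThreshold

/-!
# Birth skeleton (BC3) for piece X₂ = `SosCapturesCertifiers` (stmt-PneNP-17626) — line `quiet-planting`

Strategist decomposition of `RandomRamseyHypothesis` (stmt-PneNP-2050): X ⇐ X₁ ∧ X₂ (SOS pincer).
This file: the registered skeleton of X₂ ("polynomial-degree SOS captures every sound polynomial-time arrowing
certifier on the window ensemble": for `0 < δ < 1/15`, every `c > 0` and every sound poly-time `f`,
`Pr[f accepts G ∧ degree-⌊n^c⌋ SOS fails to refute the non-arrowing CNF of G] → 0` over `G ∼ G(n, n^{δ-2/5})`).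

LINE (the wall in its planted form — the honest state of the art; a TRANSFER from the stronger, CONSTRUCTIVE statement U).
A QUIET NON-ARROWING PLANTING (`QuietNonArrowingPlanting` = U, crux stmt-PneNP-2052 of the route: laws `Pₙ` supported on
non-arrowing graphs that no polynomial-time predicate tells from `G(n, n^{δ-2/5})`) forces every SOUND certifier to accept
`G(n, n^{δ-2/5})` with vanishing probability: soundness makes its acceptance set disjoint from `supp Pₙ`
(`soundRejectsPlanted`, proved here), the transport lemma `stub_acceptanceTransport` carries acceptance probability `0` back to
the null up to `o(1)` and down to the SOS-conditioned sub-event.  Why U is the EASIER handle although it is logically stronger: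
it is existential/constructive — exhibit ONE planting — with named candidate witnesses (overlays `R ∪ B` of sparsified
optimally-jumbled `K₄`-free graphs, `OptimalJumbledK4Free` stmt-PneNP-2057) and its own staffing, whereas X₂ is a universal
impossibility over all of P.  The line ignores the SOS conditioning; the layer-2 plan that uses it (low-degree-quiet SAMPLABLE
overlay planting + the low-degree-to-P transfer for samplable `Sₙ`-symmetric plantings, the case Mao 2026 leaves open — see
`Literature.Barriers.PneNP.LowDegreeCounterexamples`) is recorded on the line card, not registered here.

* `stub_quietPlanting` — crux stmt-PneNP-2052 by name (shared staffing; the wall; XL).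
* `stub_acceptanceTransport` — the analytic step of every quiet-planting argument: planted acceptance `0` + quietness in `ℝ`
  ⟹ null acceptance `→ 0` in `ℝ≥0∞`, and with it every sub-event (M⁻; `ENNReal.tendsto_toReal_iff`, squeeze).
* `soundRejectsPlanted` — PROVED: soundness ⟹ acceptance probability `0` under any law supported on non-arrowing graphs.
* `SosCapturesCertifiers_of` — composition, no sorry.
-/

set_option linter.dupNamespace false
set_option linter.unusedVariables false

namespace Summit.PneNP.PneNP.Cruxes.SosCapturesCertifiers.QuietPlanting

open scoped Classical
open Filter Literature.Computability.Complexity Literature.Computability.MetaComplexity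
open Summit.PneNP.PneNP.Theses.RamseyThreshold

/-- Registered stub statements, named (the skeleton's hypotheses refer to them BY NAME).  Stub 1 IS the route item
`QuietNonArrowingPlanting` (stmt-PneNP-2052); the alias keeps the by-name discipline uniform. -/
def Registered.stub_quietPlanting : Prop :=
  QuietNonArrowingPlanting

/-- Registered stub statement (named). -/
def Registered.stub_acceptanceTransport : Prop :=
  ∀ (μP μQ μQ' : ℕ → ENNReal), (∀ n, μQ n ≤ 1) → (∀ n, μQ' n ≤ μQ n) → (∀ n, μP n = 0) →
      Tendsto (fun n => (μP n).toReal - (μQ n).toReal) atTop (nhds 0) → Tendsto μQ' atTop (nhds 0)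

/-- STUB 1 (the wall; = crux stmt-PneNP-2052 `QuietNonArrowingPlanting`, cited BY NAME so that staffing is shared; the
transfer source U, stronger than X₂ but constructive): quiet non-arrowing plantings exist in the window. -/
theorem stub_quietPlanting : Registered.stub_quietPlanting := by
  sorry

/-- STUB 2 (M⁻, the transport step): for sequences of probabilities `μP, μQ ≤ 1` and a sub-event sequence `μQ' ≤ μQ`:
if the planted probabilities vanish identically and planted-minus-null tends to `0` in `ℝ` (quietness, as typed in U), then the
null sub-event probabilities tend to `0` in `ℝ≥0∞`.  [`ENNReal.tendsto_toReal_iff`, `tendsto_of_tendsto_of_tendsto_of_le_of_le`] -/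
theorem stub_acceptanceTransport : Registered.stub_acceptanceTransport := by
  sorry

/-- PROVED (the soundness/support interface): under ANY law supported on NON-ARROWING graphs a SOUND arrowing certifier
accepts with probability `0` — its acceptance set misses the support. [`PMF.toOuterMeasure_apply_eq_zero_iff`] -/
theorem soundRejectsPlanted (n : ℕ) (P : PMF (SimpleGraph (Fin n))) (f : List Bool → Bool)
    (hsupp : ∀ G : SimpleGraph (Fin n), G ∈ P.support → ∃ c : Sym2 (Fin n) → Bool, ∀ S : Finset (Fin n), G.IsNClique 4 S →
      ∀ b : Bool, ∃ u ∈ S, ∃ v ∈ S, u ≠ v ∧ c s(u, v) ≠ b)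
    (hsound : ∀ G : SimpleGraph (Fin n), f (Literature.Computability.Complexity.encodingGraph.encode ⟨n, G⟩) = true →
      ∀ c : Sym2 (Fin n) → Bool, ∃ S : Finset (Fin n), G.IsNClique 4 S ∧ ∃ b : Bool, ∀ u ∈ S, ∀ v ∈ S, u ≠ v → c s(u, v) = b) :
    P.toOuterMeasure {G | f (Literature.Computability.Complexity.encodingGraph.encode ⟨n, G⟩) = true} = 0 := by
  rw [PMF.toOuterMeasure_apply_eq_zero_iff, Set.disjoint_left]
  intro G hG hacc
  obtain ⟨c, hc⟩ := hsupp G hG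
  obtain ⟨S, hS, b, hb⟩ := hsound G hacc c
  obtain ⟨u, hu, v, hv, huv, hne⟩ := hc S hS b
  exact hne (hb u hu v hv huv)

/-- Probabilities of a `PMF` are at most one. [folklore] -/
theorem pmf_toOuterMeasure_le_one {α : Type*} (p : PMF α) (S : Set α) : p.toOuterMeasure S ≤ 1 := by
  rw [PMF.toOuterMeasure_apply, ← p.tsum_coe]
  exact ENNReal.tsum_le_tsum fun x => Set.indicator_le_self S p x

/-- COMPOSITION (kernel-checked, no sorry): `stub_quietPlanting → stub_acceptanceTransport → SosCapturesCertifiers`.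
Given `δ, c, f`: take the planting `P` of stub 1; `soundRejectsPlanted` gives `P-acceptance = 0` for every `n`; quietness of `P`
against `f` is the real-valued limit; the SOS-conditioned acceptance event is a sub-event of acceptance; stub 2 transports. -/
theorem SosCapturesCertifiers_of (hU : Registered.stub_quietPlanting) (hT : Registered.stub_acceptanceTransport) :
    SosCapturesCertifiers := by
  intro δ hδ hδ' c hc f hf hsound
  obtain ⟨P, hsupp, hquiet⟩ := hU δ hδ hδ'
  refine hT (fun n => (P n).toOuterMeasure {G | f (Literature.Computability.Complexity.encodingGraph.encode ⟨n, G⟩) = true})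
    _ _ (fun n => pmf_toOuterMeasure_le_one _ _) (fun n => ?_) (fun n => soundRejectsPlanted n (P n) f (hsupp n) (hsound n))
    (hquiet f hf)
  exact MeasureTheory.OuterMeasure.mono _ fun G hG => hG.1

/-- The piece from the two registered stubs (by name). -/
theorem SosCapturesCertifiers_closed : SosCapturesCertifiers :=
  SosCapturesCertifiers_of stub_quietPlanting stub_acceptanceTransport

end Summit.PneNP.PneNP.Cruxes.SosCapturesCertifiers.QuietPlanting
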